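import Literature.MathematicalPhysics.QuantumLattice.InfVolFermionState
import HarnessLib

/-!
# Convex combinations of infinite-volume fermion states: the density is affine, and every
# intermediate density is realised by a translation-invariant mixture with interpolated mean energy

Topic `Literature/MathematicalPhysics/QuantumLattice` (family `hubbard`, model-free). Companion of the
`#### Convex combinations` block of `InfVolFermionState.lean` (`InfVolFermionState.mix`, `mix_expect`,
`IsTranslationInvariant.mix`, `meanEnergy_mix`): the two missing affine read-outs and the intermediate-value
construction used by the pinning-field programme of the Hubbard cuprate cell (rung CQ, CQ-TABLE §B1-U, the
«tiled-trial-state TI bridge»): a certified sourced CAP for the translation-invariant states of density EXACTLY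
`n` is produced from TWO tiled product states of densities `n₁ < n < n₂` (open-cluster ground states at two
cluster chemical potentials) by MIXING their infinite-volume limits with the exact rational weight
`w = (n₂ − n)/(n₂ − n₁)` — the state space is convex and both the density and the mean energy are affine.

* `densityAt_mix`, `density_mix` — `ρ(t ω₁ + (1−t) ω₂) = t ρ(ω₁) + (1−t) ρ(ω₂)`.
* `exists_isTranslationInvariant_density_eq_meanEnergy_eq` — translation-invariant `ω₁, ω₂` with densities
  `n₁ < n₂` and any `n ∈ [n₁, n₂]`: the mixture with weight `w = (n₂ − n)/(n₂ − n₁)` is translation invariant,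
  has density `n`, and mean energy `w·e_Ψ(ω₁) + (1−w)·e_Ψ(ω₂)` for EVERY finite-range interaction `Ψ` and
  range parameter `R`.
* `exists_isTranslationInvariant_density_eq_meanEnergy_le` — hence, if `w·e_Ψ(ω₁) + (1−w)·e_Ψ(ω₂) ≤ u`,
  SOME translation-invariant state of density `n` has `e_Ψ ≤ u` (the hypothesis shape `hcap` of
  `Summits/Ventures/CertifiedManyBodySolver/Observables/TISourcedMinimiserChordFloor.lean`).

No definition, no named fact, no `sorry`; zero compute.

References: O. Bratteli, D. W. Robinson, *Operator Algebras and Quantum Statistical Mechanics 1* (1987),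
§2.3.2 and §4.3.1 (the state space is convex; invariant states form a convex set)
[cite: BratteliRobinsonI1987, §4.3.1]; H. Araki, H. Moriya, Rev. Math. Phys. 15 (2003) 93, §4.1
(densities of fermion lattice states) [cite: ArakiMoriya2003, §4.1].
-/

noncomputable section

namespace Literature.MathematicalPhysics.QuantumLattice

open Literature.Probability.LatticeModels

namespace InfVolFermionState

variable {d : ℕ}

/-- The site density of a convex combination is the convex combination of the site densities:
`ρ_x(t ω₁ + (1−t) ω₂) = t ρ_x(ω₁) + (1−t) ρ_x(ω₂)`. [cite: BratteliRobinsonI1987, §4.3.1] -/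
theorem densityAt_mix (t : ℝ) (ht₀ : 0 ≤ t) (ht₁ : t ≤ 1) (ω₁ ω₂ : InfVolFermionState d) (x : Site d) :
    (mix t ht₀ ht₁ ω₁ ω₂).densityAt x = t * ω₁.densityAt x + (1 - t) * ω₂.densityAt x := by
  simp only [densityAt, mix_expect, Complex.add_re, Complex.re_ofReal_mul]

/-- The density of a convex combination: `ρ(t ω₁ + (1−t) ω₂) = t ρ(ω₁) + (1−t) ρ(ω₂)`.
[cite: BratteliRobinsonI1987, §4.3.1] -/
theorem density_mix (t : ℝ) (ht₀ : 0 ≤ t) (ht₁ : t ≤ 1) (ω₁ ω₂ : InfVolFermionState d) :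
    (mix t ht₀ ht₁ ω₁ ω₂).density = t * ω₁.density + (1 - t) * ω₂.density :=
  densityAt_mix t ht₀ ht₁ ω₁ ω₂ 0

/-- **Intermediate densities by mixing.** If `ω₁, ω₂` are translation invariant with densities `n₁ < n₂`
and `n₁ ≤ n ≤ n₂`, the mixture with weight `w = (n₂ − n)/(n₂ − n₁)` on `ω₁` is translation invariant, has
density exactly `n`, and mean energy `w·e_Ψ(ω₁) + (1 − w)·e_Ψ(ω₂)` for every finite-range interaction `Ψ`
and every `R`. [cite: BratteliRobinsonI1987, §4.3.1] -/
theorem exists_isTranslationInvariant_density_eq_meanEnergy_eq {ω₁ ω₂ : InfVolFermionState d}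
    (h₁ : ω₁.IsTranslationInvariant) (h₂ : ω₂.IsTranslationInvariant) {n₁ n₂ n : ℝ}
    (hn₁ : ω₁.density = n₁) (hn₂ : ω₂.density = n₂) (hlt : n₁ < n₂) (hle₁ : n₁ ≤ n) (hle₂ : n ≤ n₂) :
    ∃ σ : InfVolFermionState d, σ.IsTranslationInvariant ∧ σ.density = n ∧
      ∀ (Ψ : FermionInteraction d) (R : ℝ),
        σ.meanEnergy Ψ R = (n₂ - n) / (n₂ - n₁) * ω₁.meanEnergy Ψ R +
          (1 - (n₂ - n) / (n₂ - n₁)) * ω₂.meanEnergy Ψ R := by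
  have hd : 0 < n₂ - n₁ := sub_pos.2 hlt
  have hw₀ : 0 ≤ (n₂ - n) / (n₂ - n₁) := div_nonneg (sub_nonneg.2 hle₂) hd.le
  have hw₁ : (n₂ - n) / (n₂ - n₁) ≤ 1 := by
    rw [div_le_one hd]
    linarith
  refine ⟨mix _ hw₀ hw₁ ω₁ ω₂, h₁.mix h₂ _ hw₀ hw₁, ?_, fun Ψ R => meanEnergy_mix Ψ R _ hw₀ hw₁ ω₁ ω₂⟩
  rw [density_mix, hn₁, hn₂]
  field_simp
  ring

/-- **A cap for the density-`n` class from two bracketing states** (the `hcap` shape of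
`TISourcedMinimiserChordFloor.lean`): translation-invariant `ω₁, ω₂` with densities `n₁ < n₂`, `n ∈ [n₁, n₂]`,
and `w·e_Ψ(ω₁) + (1 − w)·e_Ψ(ω₂) ≤ u` for `w = (n₂ − n)/(n₂ − n₁)` give SOME translation-invariant state of
density `n` with `e_Ψ ≤ u`. [cite: BratteliRobinsonI1987, §4.3.1] -/
theorem exists_isTranslationInvariant_density_eq_meanEnergy_le {ω₁ ω₂ : InfVolFermionState d}
    (h₁ : ω₁.IsTranslationInvariant) (h₂ : ω₂.IsTranslationInvariant) {n₁ n₂ n : ℝ}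
    (hn₁ : ω₁.density = n₁) (hn₂ : ω₂.density = n₂) (hlt : n₁ < n₂) (hle₁ : n₁ ≤ n) (hle₂ : n ≤ n₂)
    (Ψ : FermionInteraction d) (R : ℝ) {u : ℝ}
    (hu : (n₂ - n) / (n₂ - n₁) * ω₁.meanEnergy Ψ R + (1 - (n₂ - n) / (n₂ - n₁)) * ω₂.meanEnergy Ψ R ≤ u) :
    ∃ σ : InfVolFermionState d, σ.IsTranslationInvariant ∧ σ.density = n ∧ σ.meanEnergy Ψ R ≤ u := by
  obtain ⟨σ, hσ, hσn, hσe⟩ :=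
    exists_isTranslationInvariant_density_eq_meanEnergy_eq h₁ h₂ hn₁ hn₂ hlt hle₁ hle₂
  exact ⟨σ, hσ, hσn, (hσe Ψ R).le.trans hu⟩

/-- **Weight-free form**: bounds `e_Ψ(ω₁) ≤ e₁`, `e_Ψ(ω₂) ≤ e₂` on the two bracketing states and the
arithmetic side condition `(n₂ − n)·e₁ + (n − n₁)·e₂ ≤ u·(n₂ − n₁)` (all literals when the inputs are
certified rationals) give a translation-invariant state of density `n` with `e_Ψ ≤ u`.
[cite: BratteliRobinsonI1987, §4.3.1] -/
theorem exists_isTranslationInvariant_density_eq_meanEnergy_le' {ω₁ ω₂ : InfVolFermionState d}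
    (h₁ : ω₁.IsTranslationInvariant) (h₂ : ω₂.IsTranslationInvariant) {n₁ n₂ n e₁ e₂ u : ℝ}
    (hn₁ : ω₁.density = n₁) (hn₂ : ω₂.density = n₂) (hlt : n₁ < n₂) (hle₁ : n₁ ≤ n) (hle₂ : n ≤ n₂)
    (Ψ : FermionInteraction d) (R : ℝ) (he₁ : ω₁.meanEnergy Ψ R ≤ e₁) (he₂ : ω₂.meanEnergy Ψ R ≤ e₂)
    (hu : (n₂ - n) * e₁ + (n - n₁) * e₂ ≤ u * (n₂ - n₁)) :
    ∃ σ : InfVolFermionState d, σ.IsTranslationInvariant ∧ σ.density = n ∧ σ.meanEnergy Ψ R ≤ u := by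
  refine exists_isTranslationInvariant_density_eq_meanEnergy_le h₁ h₂ hn₁ hn₂ hlt hle₁ hle₂ Ψ R ?_
  have hd : 0 < n₂ - n₁ := sub_pos.2 hlt
  have hw₀ : 0 ≤ (n₂ - n) / (n₂ - n₁) := div_nonneg (sub_nonneg.2 hle₂) hd.le
  have hw₁ : 0 ≤ 1 - (n₂ - n) / (n₂ - n₁) := by
    rw [sub_nonneg, div_le_one hd]
    linarith
  have hone : 1 - (n₂ - n) / (n₂ - n₁) = (n - n₁) / (n₂ - n₁) := by
    field_simp
    ring
  calc (n₂ - n) / (n₂ - n₁) * ω₁.meanEnergy Ψ R + (1 - (n₂ - n) / (n₂ - n₁)) * ω₂.meanEnergy Ψ R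
      ≤ (n₂ - n) / (n₂ - n₁) * e₁ + (1 - (n₂ - n) / (n₂ - n₁)) * e₂ :=
        add_le_add (mul_le_mul_of_nonneg_left he₁ hw₀) (mul_le_mul_of_nonneg_left he₂ hw₁)
    _ = ((n₂ - n) * e₁ + (n - n₁) * e₂) / (n₂ - n₁) := by
        rw [hone]
        field_simp
    _ ≤ u := by
        rw [div_le_iff₀ hd]
        exact hu

end InfVolFermionState

end Literature.MathematicalPhysics.QuantumLattice

end
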